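import Summits.ResolutionOfSingularities.ResolutionOfSingularities.Theorems.EquisingularLiftEquisingularLiftNatStageCut
import Summits.ResolutionOfSingularities.ResolutionOfSingularities.Theorems.EquisingularLiftEquisingularLiftNatPointResolutionRel
import HarnessLib

/-!
# `EquisingularLiftNat` (EL♮, stmt-ResolutionOfSingularities-20038) — THE POINT EXIT: piece B of the stages cut (`GeFourFinishIsolated`, registered
# stub `stub_elnat_ge_four_finish` of skeleton v8.1) cut as «REACH AN EXIT» ∧ «GOOD-POINT FINISH», with the glue proved and the converse

Route `Theses/EquisingularLift.lean` (rev 4), crux chain w45b [OURS · L1 W4.5(b)], CRUX-STRATEGIST seat res-L1-w45b-strat-1 (gen 7; standing seat λ2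
ALONGSIDE the lead res-L1-w45b-lead-2 (claim on the crux, skeleton of record `SkeletonELnat-v8.1` 11d2edad9dbf9bd2: …, `stub_elnat_ge_four_reach :
GeFourReachIsolated p`, `stub_elnat_ge_four_finish : GeFourFinishIsolated p`), lead-1 (K-∀n necessity lane) and the planner plan-1). Support file for the
crux item (`--supports stmt-ResolutionOfSingularities-20038 --as helper`): it closes nothing, registers nothing and does not touch the lead's skeleton.
Sequel of `…NatStageCut.lean` (p525046: `HReach`, `ReachIsolated`, `FinishIsolated`, `stub_elnat_ge_four_of_stages`). HONEST FRAMING: OURS (cell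
res-hironaka); NOT a statement of any manuscript; candidates not facts; AI-written, AI review weaker than expert review. Kernel-checked; standard axioms only.

THE POINT EXIT. A stage `(X, σ, S)` of a horizontal E1 chain over `(ℙⁿ_O, Y, q)` MAY EXIT (`ExitAt (σ ≫ q) S`) when (i) the ambient has good
reduction (`GoodSet`: regular, uniformizer a regular PARAMETER) at every NON-REGULAR point of the reduced strict transform `V(closure S)` — nothing is
asked at its regular points, so regular centres that are NOT `O`-smooth (e.g. `V(x² − ϖ, y)`, after which the special fibre of the ambient is
singular) may occur in the prefix — and (ii) `V(closure S)_red` is ABSTRACTLY POINT-RESOLVABLE: it is identified (an isomorphism of reduced closed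
subschemes) with some `V(closure T₀)_red ⊆ F₀`, `F₀` any locally Noetherian scheme, `T₀` closed, that becomes regular after finitely many blow-ups of
the ambient `F₀` at NON-REGULAR CLOSED POINTS of the current reduced strict transform (`PtResolvable F₀ T₀` — the downstairs hypothesis `hres` of the
landed stage engine T-ISO-0-REL `pointResolution_from_stage` / `pointResolution_from_horizStage`, byte-for-byte, and `PointResolvable k n H ι` of
p508745 at `(ℙⁿ_k, range ι)` by `Iff.rfl`).
* `GoodPointFinishAt p k n H ι` (piece B1, «GOOD-POINT FINISH», every `n`): for every complete characteristic-0 DVR `O`, `π : O ↠ k`, graded `φ` over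
  `π`, `Y = range (ι ≫ Proj.map φ)` and every stage reachable from `(ℙⁿ_O, 𝟙, Y)` that may exit, some CONTINUATION (`HReach` from the stage) has
  regular reduced strict transform. By hand (OURS) this is a THEOREM, = T-ISO-0-REL re-run with the induction predicate carrying `GoodSet` instead of
  «good reduction at ALL special points»: at a non-regular point `w₁` good reduction gives flatness/integrality of the stage
  (`isIntegral_and_flat_of_goodAt`, one good point suffices), a smooth neighbourhood, a Hensel section and the section step (`pointStep`); after the
  step the new non-regular points lie over the section (good: `goodAt_of_isBlowup_section`) or correspond, off the centre where the blow-up is an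
  isomorphism, to old non-regular points (`stub_reducedStalkOverIso` as in `…NatFirstTouch`, then `stub_goodAtOverIso`). NOT proved here: it is the
  PROVER OBJECT this file isolates (M-sized; all bricks in the tree). In the regime of T-ISO-0-REL itself (good reduction at all special points) the
  continuation form IS proved below (`finish_of_exit_of_goodAll`, from `pointResolution_from_stage` with the stage predicate «reachable from the base
  AND from the stage»), which certifies that `ExitAt` / `PtResolvable` are the engine's currency.
* `ReachExitIsolatedAt p k n H ι` (piece B2, «REACH AN EXIT», the residual): from every stage reachable from `(ℙⁿ_O, 𝟙, Y)` with finitely many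
  non-regular points on `V(closure S₁)` and good reduction at each (the hypothesis of `FinishIsolatedAt`, verbatim), some continuation may exit.
* GLUE (pure logic, `hReach_trans`): `finishIsolatedAt_of_goodPointFinishAt_of_reachExitIsolatedAt` (B1 ∧ B2 ⟹ B per hypersurface); CONVERSE
  `reachExitIsolatedAt_of_finishIsolatedAt` (B ⟹ B2: a regular end may exit — `ExitAt` with `F₀` the end itself, `T₀ = closure S′`, the empty
  downstairs chain; `exitAt_of_isRegular`), so MODULO B1 the registered residual `GeFourFinishIsolated p` is EQUIVALENT to `GeFourReachExitIsolated p`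
  (`geFourFinishIsolated_iff_geFourReachExitIsolated_of_goodPointFinish`); for the lead: `stub_elnat_ge_four_finish_of_exit : GoodPointFinish p →
  GeFourReachExitIsolated p → GeFourFinishIsolated p`.
* WHOLE-CHAIN FORM (every `n`, no isolated intermediate stage): `ReachExitAt p k n H ι` — with some complete `O`, from `(ℙⁿ_O, 𝟙, Y)` some reachable
  stage may exit; `horizAt_of_reachExitAt_of_goodPointFinishAt`, `equisingularLiftNat_of_reachExit_of_goodPointFinish : (∀ p, ReachExit p) → (∀ p,
  GoodPointFinish p) → EquisingularLiftNat` (the crux BY NAME), `stub_elnat_ge_four_of_reachExit` (registered v6/v8.1 band text), and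
  `geFourReachExit_of_stages` (A ∧ B2 ⟹ reach an exit on the band).

WHY THIS CUT (by hand, OURS). (1) It separates from piece B the part that is a theorem (B1) and names the honest residual (B2) in the currency in which
the lead's rungs are built (res-L1-w45b-lead-2 LEAD-MEMO-6 §2: «downstairs text → K5′ Reach-instance → upstairs supplier»): every rung is a way of
REACHING AN EXIT. The landed engines run their point steps from the BASE `(ℙⁿ_O, 𝟙, Y)` (K5′ `target_elnat_of_subchainResolution'`, T-ISO-0-REL
`pointResolution_from_horizStage`) or from a stage with good reduction at ALL special points (`pointResolution_from_stage`, `pointStep`), i.e. after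
`O`-SMOOTH prefixes only; B1 is the brick that lets a point-resolution run AFTER a prefix of steps with thick regular centres (ambient regular, no longer
`O`-smooth), asking good reduction only at the points where it is used. (2) B2 is not B reworded: B asks a regular end, B2 an exit (a point-resolvable
end with good reduction at its non-regular points); B ⟹ B2 is two lines (`exitAt_of_isRegular`), B2 ⟹ B is B1. (3) STRENGTH: B2 on the band `4 ≤ n`
still contains «every hypersurface of dimension ≥ 3 over `k̄` with isolated singularities reaches, along liftable horizontal E1 steps, an absolutely
point-resolvable model» — open; for `n ≥ 5` the census word of record («≡ summit») is unchanged by this file.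
-/

set_option linter.dupNamespace false -- mandated namespace `Summit.<Summit>.<Problem>` of this single-conjunct summit

open CategoryTheory CategoryTheory.Limits AlgebraicGeometry TopologicalSpace Topology
open Literature.AlgebraicGeometry.Resolution
open AlgebraicGeometry.Scheme.IdealSheafData
open Summit.ResolutionOfSingularities.ResolutionOfSingularities.Theses.EquisingularLift.Split
open Summit.ResolutionOfSingularities.ResolutionOfSingularities.Cruxes.EquisingularLift.StrataSplit
open Summit.ResolutionOfSingularities.ResolutionOfSingularities.Cruxes.EquisingularLiftNat.Sections
open Summit.ResolutionOfSingularities.ResolutionOfSingularities.Theorems.EquisingularLift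
open Summit.ResolutionOfSingularities.ResolutionOfSingularities.Theorems.EquisingularLiftNatBands
open Summit.ResolutionOfSingularities.ResolutionOfSingularities.Theorems.EquisingularLiftNatResidualCut
open Summit.ResolutionOfSingularities.ResolutionOfSingularities.Theorems.EquisingularLiftNatStageCut

namespace Summit.ResolutionOfSingularities.ResolutionOfSingularities.Theorems.EquisingularLiftNatPointExit

/-! ## Abstract point-resolvability and the exit condition of a stage -/
/-- [OURS · L1 W4.5(b)] **`V(closure T₀)_red ⊆ F₀` is POINT-RESOLVABLE**: some `(F′, ρ′, T′)` in the closure of `(F₀, 𝟙, T₀)` under blow-ups of the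
ambient at NON-REGULAR CLOSED POINTS of the current reduced strict transform has regular reduced strict transform — the downstairs hypothesis `hres`
of T-ISO-0-REL (`pointResolution_from_stage`, `pointResolution_from_horizStage`) byte-for-byte, and `PointResolvable k n H ι` (p508745) at
`(ℙⁿ_k, range ι)` (`pointResolvable_iff_ptResolvable`). [folklore] -/
def PtResolvable (F₀ : AlgebraicGeometry.Scheme.{0}) (T₀ : Set F₀) : Prop :=
  ∃ (F' : AlgebraicGeometry.Scheme.{0}) (ρ' : F' ⟶ F₀) (T' : Set F'), (∀ Q : (∀ F₁ : AlgebraicGeometry.Scheme.{0}, (F₁ ⟶ F₀) → Set F₁ → Prop), Q F₀ (CategoryTheory.CategoryStruct.id F₀) T₀ → (∀ (F₁ F₂ : AlgebraicGeometry.Scheme.{0}) (ρ : F₁ ⟶ F₀) (T₁ : Set F₁) (x : ↥(AlgebraicGeometry.Scheme.IdealSheafData.vanishingIdeal (⟨closure T₁, isClosed_closure⟩ : TopologicalSpace.Closeds F₁)).subscheme) (υ : F₂ ⟶ F₁) (hx : IsClosed ({((AlgebraicGeometry.Scheme.IdealSheafData.vanishingIdeal (⟨closure T₁, isClosed_closure⟩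 : TopologicalSpace.Closeds F₁)).subschemeι x : F₁)} : Set F₁)), Q F₁ ρ T₁ → ¬ IsRegularLocalRing ((AlgebraicGeometry.Scheme.IdealSheafData.vanishingIdeal (⟨closure T₁, isClosed_closure⟩ : TopologicalSpace.Closeds F₁)).subscheme.presheaf.stalk x) → Literature.AlgebraicGeometry.Resolution.IsBlowup υ (AlgebraicGeometry.Scheme.IdealSheafData.vanishingIdeal (⟨{((AlgebraicGeometry.Scheme.IdealSheafData.vanishingIdeal (⟨closure T₁, isClosed_closure⟩ : TopologicalSpace.Closeds F₁)).subschemeι x : F₁)}, hx⟩ : TopologicalSpace.Closeds F₁)) → Q F₂ (CategoryTheory.CategoryStruct.comp υ ρ) (closure (υ ⁻¹' (T₁ \ {((AlgebraicGeometry.Scheme.IdealSheafData.vanishingIdeal (⟨closure T₁, isClosed_closure⟩ : TopologicalSpace.Closeds F₁)).subschemeι x : F₁)})))) → Q F' ρ' T') ∧ Literature.AlgebraicGeometry.Resolution.Scheme.IsRegular (AlgebraicGeometry.Scheme.IdealSheafData.vanishingIdeal (⟨closure T', isClosed_closure⟩ : TopologicalSpace.Closeds F')).subscheme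

/-- `PointResolvable k n H ι` (p508745) is `PtResolvable` at `(ℙⁿ_k, range ι)`. [folklore] -/
theorem pointResolvable_iff_ptResolvable (k : Type) [Field k] (n : ℕ) (H : AlgebraicGeometry.Scheme.{0}) (ι : H ⟶ (Literature.AlgebraicGeometry.Motives.projectiveSpace n k).left) :
    PointResolvable k n H ι ↔ PtResolvable (Literature.AlgebraicGeometry.Motives.projectiveSpace n k).left (Set.range ι) :=
  Iff.rfl

/-- [OURS · L1 W4.5(b)] **THE EXIT CONDITION of a stage** `(X, σ, S)` with structure morphism `r = σ ≫ q : X → Spec O`: the ambient has good reduction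
at every NON-REGULAR point of `V(closure S)_red` (`GoodSet`, the 08-17 clause verbatim) and `V(closure S)_red` is identified, by an isomorphism of
reduced closed subschemes, with an abstractly point-resolvable `V(closure T₀)_red ⊆ F₀` (`F₀` locally Noetherian, `T₀` closed). [folklore] -/
def ExitAt {O : Type} [CommRing O] {X : AlgebraicGeometry.Scheme.{0}} (r : X ⟶ AlgebraicGeometry.Spec (.of O)) (S : Set X) : Prop :=
  GoodSet r S ∧ ∃ (F₀ : AlgebraicGeometry.Scheme.{0}) (_ : AlgebraicGeometry.IsLocallyNoetherian F₀) (T₀ : Set F₀), IsClosed T₀ ∧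
    Nonempty ((AlgebraicGeometry.Scheme.IdealSheafData.vanishingIdeal (⟨closure T₀, isClosed_closure⟩ : TopologicalSpace.Closeds F₀)).subscheme ≅ (AlgebraicGeometry.Scheme.IdealSheafData.vanishingIdeal (⟨closure S, isClosed_closure⟩ : TopologicalSpace.Closeds X)).subscheme) ∧ PtResolvable F₀ T₀

/-- **A stage with REGULAR reduced strict transform may exit** (locally Noetherian ambient): `GoodSet` is vacuous, and `V(closure S)_red` is its own
point-resolution (`F₀ = X`, `T₀ = closure S`, the empty downstairs chain). [folklore] -/
theorem exitAt_of_isRegular {O : Type} [CommRing O] {X : AlgebraicGeometry.Scheme.{0}} [AlgebraicGeometry.IsLocallyNoetherian X]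
    (r : X ⟶ AlgebraicGeometry.Spec (.of O)) (S : Set X) (hreg : Literature.AlgebraicGeometry.Resolution.Scheme.IsRegular (AlgebraicGeometry.Scheme.IdealSheafData.vanishingIdeal (⟨closure S, isClosed_closure⟩ : TopologicalSpace.Closeds X)).subscheme) : ExitAt r S := by
  have hZ : (⟨closure (closure S), isClosed_closure⟩ : TopologicalSpace.Closeds X) = ⟨closure S, isClosed_closure⟩ :=
    TopologicalSpace.Closeds.ext closure_closure
  refine ⟨fun x hx => absurd (hreg x) hx, X, inferInstance, closure S, isClosed_closure, ⟨eqToIso (by rw [hZ])⟩, ?_⟩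
  refine ⟨X, CategoryTheory.CategoryStruct.id X, closure S, fun Q h0 _ => h0, ?_⟩
  rw [hZ]
  exact hreg

/-- **PtResolvable is what T-ISO-0-REL consumes, and the engine CONTINUES the stage**: in the regime of `pointResolution_from_stage` (smooth proper
`q : P → Spec O` over a complete DVR with algebraically closed residue field, `Y` closed irreducible in the special fibre, a stage reachable from
`(P, 𝟙, Y)` under the horizontal E1 steps with irreducible special fibre and good reduction at ALL its special points, identified downstairs with a
point-resolvable `(F₀, T₀)`), some CONTINUATION of the stage — `HReach` FROM THE STAGE, not only from the base — has regular reduced strict transform: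
`pointResolution_from_stage` with the stage predicate «reachable from the base and from the stage». The `GoodSet` version of this theorem is
`GoodPointFinishAt` below (not proved here). [folklore] -/
theorem finish_of_exit_of_goodAll (O : Type) [CommRing O] [IsDomain O] [IsDiscreteValuationRing O]
    [IsAdicComplete (IsLocalRing.maximalIdeal O) O] [IsAlgClosed (IsLocalRing.ResidueField O)]
    (P : AlgebraicGeometry.Scheme.{0}) (q : P ⟶ AlgebraicGeometry.Spec (.of O)) (Y : TopologicalSpace.Closeds P)
    (hq : AlgebraicGeometry.Smooth q) (hqp : AlgebraicGeometry.IsProper q)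
    (hY : (Y : Set P) ⊆ q ⁻¹' {IsLocalRing.closedPoint O}) (hYirr : IsIrreducible (Y : Set P))
    (X₁ : AlgebraicGeometry.Scheme.{0}) (σ₁ : X₁ ⟶ P) (S₁ : Set X₁)
    (hH : HReach q (Y : Set P) P (CategoryTheory.CategoryStruct.id P) (Y : Set P) X₁ σ₁ S₁)
    (hirr : IsIrreducible ((CategoryTheory.CategoryStruct.comp σ₁ q) ⁻¹' {IsLocalRing.closedPoint O}))
    (hgood : ∀ w : X₁, (CategoryTheory.CategoryStruct.comp σ₁ q) w = IsLocalRing.closedPoint O → GoodAt (CategoryTheory.CategoryStruct.comp σ₁ q) w)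
    (F₀ : AlgebraicGeometry.Scheme.{0}) [AlgebraicGeometry.IsLocallyNoetherian F₀] (T₀ : Set F₀) (hT₀cl : IsClosed T₀) (hT₀irr : IsIrreducible T₀)
    (e : (AlgebraicGeometry.Scheme.IdealSheafData.vanishingIdeal (⟨closure T₀, isClosed_closure⟩ : TopologicalSpace.Closeds F₀)).subscheme ≅ (AlgebraicGeometry.Scheme.IdealSheafData.vanishingIdeal (⟨closure S₁, isClosed_closure⟩ : TopologicalSpace.Closeds X₁)).subscheme)
    (hres : PtResolvable F₀ T₀) :
    ∃ (X₂ : AlgebraicGeometry.Scheme.{0}) (σ₂ : X₂ ⟶ P) (S₂ : Set X₂), HReach q (Y : Set P) X₁ σ₁ S₁ X₂ σ₂ S₂ ∧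
      (∀ w : X₂, (CategoryTheory.CategoryStruct.comp σ₂ q) w = IsLocalRing.closedPoint O → GoodAt (CategoryTheory.CategoryStruct.comp σ₂ q) w) ∧
      Literature.AlgebraicGeometry.Resolution.Scheme.IsRegular (AlgebraicGeometry.Scheme.IdealSheafData.vanishingIdeal (⟨closure S₂, isClosed_closure⟩ : TopologicalSpace.Closeds X₂)).subscheme := by
  obtain ⟨X₂, σ₂, S₂, ⟨-, h₂⟩, -, hgood₂, hreg₂⟩ := pointResolution_from_stage O P q Y
    (fun X' σ' S' => HReach q (Y : Set P) P (CategoryTheory.CategoryStruct.id P) (Y : Set P) X' σ' S' ∧ HReach q (Y : Set P) X₁ σ₁ S₁ X' σ' S')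
    (fun X' σ S h => chain_of_horizChainE1 q (Y : Set P) σ S h.1)
    (fun X' X'' σ' S' C τ h hb hr hfl hg hE => ⟨hReach_step C τ h.1 hb hr hfl hg hE, hReach_step C τ h.2 hb hr hfl hg hE⟩)
    hq hqp hY hYirr X₁ σ₁ S₁ ⟨hH, hReach_refl X₁ σ₁ S₁⟩ hirr hgood F₀ T₀ hT₀cl hT₀irr e hres
  exact ⟨X₂, σ₂, S₂, h₂, hgood₂, hreg₂⟩

/-! ## The pieces, per hypersurface `(p, k, n, H, ι)` -/

/-- [OURS · L1 W4.5(b)] **Piece B1 — GOOD-POINT FINISH** at the hypersurface `(k, n, H, ι)` (every `n`): for EVERY complete characteristic-0 DVR `O` with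
`π : O ↠ k`, every graded `φ` over `π`, `Y = range (ι ≫ Proj.map φ)` and every stage `(X₁, σ₁, S₁)` reachable from `(ℙⁿ_O, 𝟙, Y)` under the horizontal
E1 steps that MAY EXIT (`ExitAt`: good reduction at the non-regular points of `V(closure S₁)_red`, which is abstractly point-resolvable), some
CONTINUATION has regular reduced strict transform. By hand a theorem (T-ISO-0-REL `pointResolution_from_horizStage` in `GoodSet` currency: `pointStep`
+ `stub_reducedStalkOverIso` + `stub_goodAtOverIso`); filed as a route-side statement to be proved, NOT as a fact. [folklore] -/
def GoodPointFinishAt (p : ℕ) (k : Type) [Field k] [CharP k p] [IsAlgClosed k] (n : ℕ) (H : AlgebraicGeometry.Scheme.{0}) (ι : H ⟶ (Literature.AlgebraicGeometry.Motives.projectiveSpace n k).left) : Prop :=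
  ∀ (O : Type) [CommRing O] [IsDomain O] [IsDiscreteValuationRing O] [CharZero O] [IsAdicComplete (IsLocalRing.maximalIdeal O) O] (π : O →+* k), Function.Surjective π → (letI := MvPolynomial.gradedAlgebra (σ := Fin (n + 1)) (R := O); letI := MvPolynomial.gradedAlgebra (σ := Fin (n + 1)) (R := k); ∀ (φ : MvPolynomial.homogeneousSubmodule (Fin (n + 1)) O →+*ᵍ MvPolynomial.homogeneousSubmodule (Fin (n + 1)) k) (hφ' : HomogeneousIdeal.irrelevant (MvPolynomial.homogeneousSubmodule (Fin (n + 1)) k) ≤ (HomogeneousIdeal.irrelevant (MvPolynomial.homogeneousSubmodule (Fin (n + 1)) O)).map φ), (∀ s, φ s = MvPolynomial.map π s) → ∀ Y : Set (AlgebraicGeometry.Proj (MvPolynomial.homogeneousSubmodule (Fin (n + 1)) O)), Y = Set.range (CategoryTheory.CategoryStruct.comp ι (AlgebraicGeometry.Proj.map φ hφ') : H ⟶ (AlgebraicGeometry.Proj (MvPolynomial.homogeneousSubmodule (Fin (n + 1)) O))) → ∀ (X₁ : AlgebraicGeometry.Scheme.{0}) (σ₁ : X₁ ⟶ (AlgebraicGeometry.Proj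 (MvPolynomial.homogeneousSubmodule (Fin (n + 1)) O))) (S₁ : Set X₁), HReach (CategoryTheory.CategoryStruct.comp (AlgebraicGeometry.Proj.toSpecZero (MvPolynomial.homogeneousSubmodule (Fin (n + 1)) O)) (AlgebraicGeometry.Spec.map (CommRingCat.ofHom (algebraMap O (MvPolynomial.homogeneousSubmodule (Fin (n + 1)) O 0))))) Y (AlgebraicGeometry.Proj (MvPolynomial.homogeneousSubmodule (Fin (n + 1)) O)) (CategoryTheory.CategoryStruct.id _) Y X₁ σ₁ S₁ → ExitAt (CategoryTheory.CategoryStruct.comp σ₁ (CategoryTheory.CategoryStruct.comp (AlgebraicGeometry.Proj.toSpecZero (MvPolynomial.homogeneousSubmodule (Fin (n + 1)) O)) (AlgebraicGeometry.Spec.map (CommRingCat.ofHom (algebraMap O (MvPolynomial.homogeneousSubmodule (Fin (n + 1)) O 0)))))) S₁ → ∃ (P' : AlgebraicGeometry.Scheme.{0}) (σ : P' ⟶ (AlgebraicGeometry.Proj (MvPolynomial.homogeneousSubmodule (Fin (n + 1)) O))) (S' : Set P'), HReach (CategoryTheory.CategoryStruct.comp (AlgebraicGeometry.Proj.toSpecZero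 (MvPolynomial.homogeneousSubmodule (Fin (n + 1)) O)) (AlgebraicGeometry.Spec.map (CommRingCat.ofHom (algebraMap O (MvPolynomial.homogeneousSubmodule (Fin (n + 1)) O 0))))) Y X₁ σ₁ S₁ P' σ S' ∧ Literature.AlgebraicGeometry.Resolution.Scheme.IsRegular (AlgebraicGeometry.Scheme.IdealSheafData.vanishingIdeal (⟨closure S', isClosed_closure⟩ : TopologicalSpace.Closeds P')).subscheme)

/-- [OURS · L1 W4.5(b)] **Piece B2 — REACH AN EXIT** at `(k, n, H, ι)`: for EVERY complete characteristic-0 DVR `O` with `π : O ↠ k`, every graded `φ`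
over `π`, `Y = range (ι ≫ Proj.map φ)` and every stage reachable from `(ℙⁿ_O, 𝟙, Y)` with finitely many non-regular points on `V(closure S₁)` and good
reduction of the ambient at each of them (the hypothesis of `FinishIsolatedAt`, verbatim), some CONTINUATION may exit. A route-posited OPEN statement
(the residual of piece B; not a published result). [folklore] -/
def ReachExitIsolatedAt (p : ℕ) (k : Type) [Field k] [CharP k p] [IsAlgClosed k] (n : ℕ) (H : AlgebraicGeometry.Scheme.{0}) (ι : H ⟶ (Literature.AlgebraicGeometry.Motives.projectiveSpace n k).left) : Prop :=
  ∀ (O : Type) [CommRing O] [IsDomain O] [IsDiscreteValuationRing O] [CharZero O] [IsAdicComplete (IsLocalRing.maximalIdeal O) O] (π : O →+* k), Function.Surjective π → (letI := MvPolynomial.gradedAlgebra (σ := Fin (n + 1)) (R := O); letI := MvPolynomial.gradedAlgebra (σ := Fin (n + 1)) (R := k); ∀ (φ : MvPolynomial.homogeneousSubmodule (Fin (n + 1)) O →+*ᵍ MvPolynomial.homogeneousSubmodule (Fin (n + 1)) k) (hφ' : HomogeneousIdeal.irrelevant (MvPolynomial.homogeneousSubmodule (Fin (n + 1)) k) ≤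 (HomogeneousIdeal.irrelevant (MvPolynomial.homogeneousSubmodule (Fin (n + 1)) O)).map φ), (∀ s, φ s = MvPolynomial.map π s) → ∀ Y : Set (AlgebraicGeometry.Proj (MvPolynomial.homogeneousSubmodule (Fin (n + 1)) O)), Y = Set.range (CategoryTheory.CategoryStruct.comp ι (AlgebraicGeometry.Proj.map φ hφ') : H ⟶ (AlgebraicGeometry.Proj (MvPolynomial.homogeneousSubmodule (Fin (n + 1)) O))) → ∀ (X₁ : AlgebraicGeometry.Scheme.{0}) (σ₁ : X₁ ⟶ (AlgebraicGeometry.Proj (MvPolynomial.homogeneousSubmodule (Fin (n + 1)) O))) (S₁ : Set X₁), HReach (CategoryTheory.CategoryStruct.comp (AlgebraicGeometry.Proj.toSpecZero (MvPolynomial.homogeneousSubmodule (Fin (n + 1)) O)) (AlgebraicGeometry.Spec.map (CommRingCat.ofHom (algebraMap O (MvPolynomial.homogeneousSubmodule (Fin (n + 1)) O 0))))) Y (AlgebraicGeometry.Proj (MvPolynomial.homogeneousSubmodule (Fin (n + 1)) O)) (CategoryTheory.CategoryStruct.id _) Y X₁ σ₁ S₁ → (singSet S₁).Finite → GoodSet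 (CategoryTheory.CategoryStruct.comp σ₁ (CategoryTheory.CategoryStruct.comp (AlgebraicGeometry.Proj.toSpecZero (MvPolynomial.homogeneousSubmodule (Fin (n + 1)) O)) (AlgebraicGeometry.Spec.map (CommRingCat.ofHom (algebraMap O (MvPolynomial.homogeneousSubmodule (Fin (n + 1)) O 0)))))) S₁ → ∃ (X₂ : AlgebraicGeometry.Scheme.{0}) (σ₂ : X₂ ⟶ (AlgebraicGeometry.Proj (MvPolynomial.homogeneousSubmodule (Fin (n + 1)) O))) (S₂ : Set X₂), HReach (CategoryTheory.CategoryStruct.comp (AlgebraicGeometry.Proj.toSpecZero (MvPolynomial.homogeneousSubmodule (Fin (n + 1)) O)) (AlgebraicGeometry.Spec.map (CommRingCat.ofHom (algebraMap O (MvPolynomial.homogeneousSubmodule (Fin (n + 1)) O 0))))) Y X₁ σ₁ S₁ X₂ σ₂ S₂ ∧ ExitAt (CategoryTheory.CategoryStruct.comp σ₂ (CategoryTheory.CategoryStruct.comp (AlgebraicGeometry.Proj.toSpecZero (MvPolynomial.homogeneousSubmodule (Fin (n + 1)) O)) (AlgebraicGeometry.Spec.map (CommRingCat.ofHom (algebraMap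 O (MvPolynomial.homogeneousSubmodule (Fin (n + 1)) O 0)))))) S₂)

/-- [OURS · L1 W4.5(b)] **REACH AN EXIT FROM THE START** at `(k, n, H, ι)` (whole-chain form, every `n`): some COMPLETE characteristic-0 DVR `O` with
`π : O ↠ k` such that for every graded `φ` over `π` and `Y = range (ι ≫ Proj.map φ)` some stage reachable from `(ℙⁿ_O, 𝟙, Y)` may exit. A route-posited
OPEN statement. [folklore] -/
def ReachExitAt (p : ℕ) (k : Type) [Field k] [CharP k p] [IsAlgClosed k] (n : ℕ) (H : AlgebraicGeometry.Scheme.{0}) (ι : H ⟶ (Literature.AlgebraicGeometry.Motives.projectiveSpace n k).left) : Prop :=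
  ∃ (O : Type) (_ : CommRing O) (_ : IsDomain O) (_ : IsDiscreteValuationRing O) (_ : CharZero O) (_ : IsAdicComplete (IsLocalRing.maximalIdeal O) O) (π : O →+* k), Function.Surjective π ∧ (letI := MvPolynomial.gradedAlgebra (σ := Fin (n + 1)) (R := O); letI := MvPolynomial.gradedAlgebra (σ := Fin (n + 1)) (R := k); ∀ (φ : MvPolynomial.homogeneousSubmodule (Fin (n + 1)) O →+*ᵍ MvPolynomial.homogeneousSubmodule (Fin (n + 1)) k) (hφ' : HomogeneousIdeal.irrelevant (MvPolynomial.homogeneousSubmodule (Fin (n + 1)) k) ≤ (HomogeneousIdeal.irrelevant (MvPolynomial.homogeneousSubmodule (Fin (n + 1)) O)).map φ), (∀ s, φ s = MvPolynomial.map π s) → ∀ Y : Set (AlgebraicGeometry.Proj (MvPolynomial.homogeneousSubmodule (Fin (n + 1)) O)), Y = Set.range (CategoryTheory.CategoryStruct.comp ι (AlgebraicGeometry.Proj.map φ hφ') : H ⟶ (AlgebraicGeometry.Proj (MvPolynomial.homogeneousSubmodule (Fin (n + 1)) O))) → ∃ (X₂ : AlgebraicGeometry.Scheme.{0}) (σ₂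 : X₂ ⟶ (AlgebraicGeometry.Proj (MvPolynomial.homogeneousSubmodule (Fin (n + 1)) O))) (S₂ : Set X₂), HReach (CategoryTheory.CategoryStruct.comp (AlgebraicGeometry.Proj.toSpecZero (MvPolynomial.homogeneousSubmodule (Fin (n + 1)) O)) (AlgebraicGeometry.Spec.map (CommRingCat.ofHom (algebraMap O (MvPolynomial.homogeneousSubmodule (Fin (n + 1)) O 0))))) Y (AlgebraicGeometry.Proj (MvPolynomial.homogeneousSubmodule (Fin (n + 1)) O)) (CategoryTheory.CategoryStruct.id _) Y X₂ σ₂ S₂ ∧ ExitAt (CategoryTheory.CategoryStruct.comp σ₂ (CategoryTheory.CategoryStruct.comp (AlgebraicGeometry.Proj.toSpecZero (MvPolynomial.homogeneousSubmodule (Fin (n + 1)) O)) (AlgebraicGeometry.Spec.map (CommRingCat.ofHom (algebraMap O (MvPolynomial.homogeneousSubmodule (Fin (n + 1)) O 0)))))) S₂)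

/-! ## Glue per hypersurface: B1 ∧ B2 ⟹ B, and the converse B ⟹ B2 -/

/-- **B1 ∧ B2 ⟹ B** (per hypersurface): continue to an exit (B2), finish from it (B1), concatenate (`hReach_trans`). [folklore] -/
theorem finishIsolatedAt_of_goodPointFinishAt_of_reachExitIsolatedAt (p : ℕ) (k : Type) [Field k] [CharP k p] [IsAlgClosed k] (n : ℕ) (H : AlgebraicGeometry.Scheme.{0}) (ι : H ⟶ (Literature.AlgebraicGeometry.Motives.projectiveSpace n k).left)
    (hB1 : GoodPointFinishAt p k n H ι) (hB2 : ReachExitIsolatedAt p k n H ι) : FinishIsolatedAt p k n H ι := by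
  intro O _ _ _ _ _ π hπ
  letI := MvPolynomial.gradedAlgebra (σ := Fin (n + 1)) (R := O)
  letI := MvPolynomial.gradedAlgebra (σ := Fin (n + 1)) (R := k)
  intro φ hφ' hφ Y hY X₁ σ₁ S₁ hR hfin hgood
  obtain ⟨X₂, σ₂, S₂, hR₂, hexit⟩ := hB2 O π hπ φ hφ' hφ Y hY X₁ σ₁ S₁ hR hfin hgood
  obtain ⟨P', σ, S', hR', hreg⟩ := hB1 O π hπ φ hφ' hφ Y hY X₂ σ₂ S₂ (hReach_trans hR hR₂) hexit
  exact ⟨P', σ, S', hReach_trans hR₂ hR', hreg⟩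

/-- **B ⟹ B2** (per hypersurface): a regular end may exit (`exitAt_of_isRegular`; the end is locally Noetherian by `chain_isRegular` over the
smooth proper `ℙⁿ_O`). [folklore] -/
theorem reachExitIsolatedAt_of_finishIsolatedAt (p : ℕ) (k : Type) [Field k] [CharP k p] [IsAlgClosed k] (n : ℕ) (H : AlgebraicGeometry.Scheme.{0}) (ι : H ⟶ (Literature.AlgebraicGeometry.Motives.projectiveSpace n k).left)
    (h : FinishIsolatedAt p k n H ι) : ReachExitIsolatedAt p k n H ι := by
  intro O _ _ _ _ _ π hπ
  letI := MvPolynomial.gradedAlgebra (σ := Fin (n + 1)) (R := O)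
  letI := MvPolynomial.gradedAlgebra (σ := Fin (n + 1)) (R := k)
  intro φ hφ' hφ Y hY X₁ σ₁ S₁ hR hfin hgood
  obtain ⟨P', σ, S', hR', hreg⟩ := h O π hπ φ hφ' hφ Y hY X₁ σ₁ S₁ hR hfin hgood
  obtain ⟨hsm, hprop⟩ := stub_projectiveAmbientSmoothProper O n
  have hN : AlgebraicGeometry.IsLocallyNoetherian (AlgebraicGeometry.Proj (MvPolynomial.homogeneousSubmodule (Fin (n + 1)) O)) := by
    haveI := hsm
    exact AlgebraicGeometry.LocallyOfFiniteType.isLocallyNoetherian (CategoryTheory.CategoryStruct.comp (AlgebraicGeometry.Proj.toSpecZero (MvPolynomial.homogeneousSubmodule (Fin (n + 1)) O)) (AlgebraicGeometry.Spec.map (CommRingCat.ofHom (algebraMap O (MvPolynomial.homogeneousSubmodule (Fin (n + 1)) O 0)))))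
  have hRg : Literature.AlgebraicGeometry.Resolution.Scheme.IsRegular (AlgebraicGeometry.Proj (MvPolynomial.homogeneousSubmodule (Fin (n + 1)) O)) := fun y => (stub_goodAtOfSmooth O _ (CategoryTheory.CategoryStruct.comp (AlgebraicGeometry.Proj.toSpecZero (MvPolynomial.homogeneousSubmodule (Fin (n + 1)) O)) (AlgebraicGeometry.Spec.map (CommRingCat.ofHom (algebraMap O (MvPolynomial.homogeneousSubmodule (Fin (n + 1)) O 0))))) hsm y).1
  obtain ⟨hN', -, -⟩ := chain_isRegular _ Y P' σ S' (chain_of_horizChainE1 (CategoryTheory.CategoryStruct.comp (AlgebraicGeometry.Proj.toSpecZero (MvPolynomial.homogeneousSubmodule (Fin (n + 1)) O)) (AlgebraicGeometry.Spec.map (CommRingCat.ofHom (algebraMap O (MvPolynomial.homogeneousSubmodule (Fin (n + 1)) O 0))))) Y σ S' (hReach_trans hR hR')) hN hRg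
  haveI := hN'
  exact ⟨P', σ, S', hR', exitAt_of_isRegular _ S' hreg⟩

/-- **B2 ∧ B1 ⟹ `HorizAt`, whole-chain form** (per hypersurface, every `n`): take B2's complete `O` and its exit, finish with B1. [folklore] -/
theorem horizAt_of_reachExitAt_of_goodPointFinishAt (p : ℕ) (k : Type) [Field k] [CharP k p] [IsAlgClosed k] (n : ℕ) (H : AlgebraicGeometry.Scheme.{0}) (ι : H ⟶ (Literature.AlgebraicGeometry.Motives.projectiveSpace n k).left)
    (hE : ReachExitAt p k n H ι) (hB1 : GoodPointFinishAt p k n H ι) : HorizAt p k n H ι := by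
  obtain ⟨O, i1, i2, i3, i4, i5, π, hπ, hE'⟩ := hE
  letI := MvPolynomial.gradedAlgebra (σ := Fin (n + 1)) (R := O)
  letI := MvPolynomial.gradedAlgebra (σ := Fin (n + 1)) (R := k)
  refine ⟨O, i1, i2, i3, i4, π, hπ, ?_⟩
  intro φ hφ' hφ Y hY
  obtain ⟨X₂, σ₂, S₂, hR, hexit⟩ := hE' φ hφ' hφ Y hY
  obtain ⟨P', σ, S', hR', hreg⟩ := hB1 O π hπ φ hφ' hφ Y hY X₂ σ₂ S₂ hR hexit
  exact ⟨P', σ, S', hReach_trans hR hR', hreg⟩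

/-- **A ∧ B2 ⟹ reach an exit from the start** (per hypersurface). [folklore] -/
theorem reachExitAt_of_reachIsolatedAt_of_reachExitIsolatedAt (p : ℕ) (k : Type) [Field k] [CharP k p] [IsAlgClosed k] (n : ℕ) (H : AlgebraicGeometry.Scheme.{0}) (ι : H ⟶ (Literature.AlgebraicGeometry.Motives.projectiveSpace n k).left)
    (hA : ReachIsolatedAt p k n H ι) (hB2 : ReachExitIsolatedAt p k n H ι) : ReachExitAt p k n H ι := by
  obtain ⟨O, i1, i2, i3, i4, i5, π, hπ, hA'⟩ := hA
  letI := MvPolynomial.gradedAlgebra (σ := Fin (n + 1)) (R := O)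
  letI := MvPolynomial.gradedAlgebra (σ := Fin (n + 1)) (R := k)
  refine ⟨O, i1, i2, i3, i4, i5, π, hπ, ?_⟩
  intro φ hφ' hφ Y hY
  obtain ⟨X₁, σ₁, S₁, hR, hfin, hgood⟩ := hA' φ hφ' hφ Y hY
  obtain ⟨X₂, σ₂, S₂, hR₂, hexit⟩ := hB2 O π hπ φ hφ' hφ Y hY X₁ σ₁ S₁ hR hfin hgood
  exact ⟨X₂, σ₂, S₂, hReach_trans hR hR₂, hexit⟩

/-- **B2 ∧ B1 ⟹ the EL♮ conclusion block** at an integral hypersurface (every `n`; `elNatAt_of_horizAt`, p508745). [folklore] -/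
theorem elNatAt_of_reachExitAt_of_goodPointFinishAt (p : ℕ) (k : Type) [Field k] [CharP k p] [IsAlgClosed k] (n : ℕ) (H : AlgebraicGeometry.Scheme.{0}) (ι : H ⟶ (Literature.AlgebraicGeometry.Motives.projectiveSpace n k).left)
    (hι : AlgebraicGeometry.IsClosedImmersion ι) (hH : AlgebraicGeometry.IsIntegral H)
    (hE : ReachExitAt p k n H ι) (hB1 : GoodPointFinishAt p k n H ι) :
    Summit.ResolutionOfSingularities.ResolutionOfSingularities.Theorems.EquisingularLift.ELNatAt p k n H ι :=
  elNatAt_of_horizAt p k n H ι hι hH (horizAt_of_reachExitAt_of_goodPointFinishAt p k n H ι hE hB1)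

/-! ## All primes and hypersurfaces; the registered residual band `4 ≤ n` -/

/-- [OURS · L1 W4.5(b)] **Piece B1, all primes and hypersurfaces** (every `n`; the outer binders of `EquisingularLiftNat`, then `GoodPointFinishAt`). By hand a
theorem (see `GoodPointFinishAt`); the PROVER OBJECT of this cut. [folklore] -/
def GoodPointFinish (p : ℕ) : Prop :=
  p.Prime → ∀ (k : Type) [Field k] [CharP k p] [IsAlgClosed k] (n : ℕ) (H : AlgebraicGeometry.Scheme.{0}) (ι : H ⟶ (Literature.AlgebraicGeometry.Motives.projectiveSpace n k).left), AlgebraicGeometry.IsClosedImmersion ι → AlgebraicGeometry.IsIntegral H → (∀ y : (Literature.AlgebraicGeometry.Motives.projectiveSpace n k).left, ∃ U : (Literature.AlgebraicGeometry.Motives.projectiveSpace n k).left.affineOpens, y ∈ (U : (Literature.AlgebraicGeometry.Motives.projectiveSpace n k).left.Opens) ∧ (ι.ker.ideal U).IsPrincipal) → GoodPointFinishAt p k n H ι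

/-- [OURS · L1 W4.5(b)] **Reach an exit from the start, all primes and hypersurfaces** (every `n`). [folklore] -/
def ReachExit (p : ℕ) : Prop :=
  p.Prime → ∀ (k : Type) [Field k] [CharP k p] [IsAlgClosed k] (n : ℕ) (H : AlgebraicGeometry.Scheme.{0}) (ι : H ⟶ (Literature.AlgebraicGeometry.Motives.projectiveSpace n k).left), AlgebraicGeometry.IsClosedImmersion ι → AlgebraicGeometry.IsIntegral H → (∀ y : (Literature.AlgebraicGeometry.Motives.projectiveSpace n k).left, ∃ U : (Literature.AlgebraicGeometry.Motives.projectiveSpace n k).left.affineOpens, y ∈ (U : (Literature.AlgebraicGeometry.Motives.projectiveSpace n k).left.Opens) ∧ (ι.ker.ideal U).IsPrincipal) → ReachExitAt p k n H ι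

/-- [OURS · L1 W4.5(b)] **Piece B2 on the residual band** (`4 ≤ n`, `H` not regular — the hypothesis prefix of `GeFourFinishIsolated`, then
`ReachExitIsolatedAt`). [folklore] -/
def GeFourReachExitIsolated (p : ℕ) : Prop :=
  p.Prime → ∀ (k : Type) [Field k] [CharP k p] [IsAlgClosed k] (n : ℕ) (H : AlgebraicGeometry.Scheme.{0}) (ι : H ⟶ (Literature.AlgebraicGeometry.Motives.projectiveSpace n k).left), AlgebraicGeometry.IsClosedImmersion ι → AlgebraicGeometry.IsIntegral H → (∀ y : (Literature.AlgebraicGeometry.Motives.projectiveSpace n k).left, ∃ U : (Literature.AlgebraicGeometry.Motives.projectiveSpace n k).left.affineOpens, y ∈ (U : (Literature.AlgebraicGeometry.Motives.projectiveSpace n k).left.Opens) ∧ (ι.ker.ideal U).IsPrincipal) → 4 ≤ n → ¬ Literature.AlgebraicGeometry.Resolution.Scheme.IsRegular H → ReachExitIsolatedAt p k n H ι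

/-- [OURS · L1 W4.5(b)] **Reach an exit from the start, on the residual band.** [folklore] -/
def GeFourReachExit (p : ℕ) : Prop :=
  p.Prime → ∀ (k : Type) [Field k] [CharP k p] [IsAlgClosed k] (n : ℕ) (H : AlgebraicGeometry.Scheme.{0}) (ι : H ⟶ (Literature.AlgebraicGeometry.Motives.projectiveSpace n k).left), AlgebraicGeometry.IsClosedImmersion ι → AlgebraicGeometry.IsIntegral H → (∀ y : (Literature.AlgebraicGeometry.Motives.projectiveSpace n k).left, ∃ U : (Literature.AlgebraicGeometry.Motives.projectiveSpace n k).left.affineOpens, y ∈ (U : (Literature.AlgebraicGeometry.Motives.projectiveSpace n k).left.Opens) ∧ (ι.ker.ideal U).IsPrincipal) → 4 ≤ n → ¬ Literature.AlgebraicGeometry.Resolution.Scheme.IsRegular H → ReachExitAt p k n H ι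

/-- **THE SUB-CUT OF THE REGISTERED RESIDUAL STUB `stub_elnat_ge_four_finish : GeFourFinishIsolated p`** (skeleton v8.1): from B1 (every `n`) and B2 on
the band. For the lead (a reshape of the stub along this theorem is the LEAD's call). [folklore] -/
theorem stub_elnat_ge_four_finish_of_exit (p : ℕ) (hB1 : GoodPointFinish p) (hB2 : GeFourReachExitIsolated p) : GeFourFinishIsolated p :=
  fun hp k _ _ _ n H ι hι hH hloc hn hHreg =>
    finishIsolatedAt_of_goodPointFinishAt_of_reachExitIsolatedAt p k n H ι (hB1 hp k n H ι hι hH hloc) (hB2 hp k n H ι hι hH hloc hn hHreg)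

/-- **Converse on the band: `GeFourFinishIsolated p → GeFourReachExitIsolated p`.** [folklore] -/
theorem geFourReachExitIsolated_of_geFourFinishIsolated (p : ℕ) (h : GeFourFinishIsolated p) : GeFourReachExitIsolated p :=
  fun hp k _ _ _ n H ι hι hH hloc hn hHreg => reachExitIsolatedAt_of_finishIsolatedAt p k n H ι (h hp k n H ι hι hH hloc hn hHreg)

/-- **MODULO B1 THE RESIDUAL STUB IS EQUIVALENT TO «REACH AN EXIT»**: `GoodPointFinish p → (GeFourFinishIsolated p ↔ GeFourReachExitIsolated p)`.
[folklore] -/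
theorem geFourFinishIsolated_iff_geFourReachExitIsolated_of_goodPointFinish (p : ℕ) (hB1 : GoodPointFinish p) :
    GeFourFinishIsolated p ↔ GeFourReachExitIsolated p :=
  ⟨geFourReachExitIsolated_of_geFourFinishIsolated p, stub_elnat_ge_four_finish_of_exit p hB1⟩

/-- **A ∧ B2 ⟹ reach an exit from the start, on the band** (`GeFourReachIsolated p` is `stub_elnat_ge_four_reach` of skeleton v8.1). [folklore] -/
theorem geFourReachExit_of_stages (p : ℕ) (hA : GeFourReachIsolated p) (hB2 : GeFourReachExitIsolated p) : GeFourReachExit p :=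
  fun hp k _ _ _ n H ι hι hH hloc hn hHreg =>
    reachExitAt_of_reachIsolatedAt_of_reachExitIsolatedAt p k n H ι (hA hp k n H ι hι hH hloc hn hHreg) (hB2 hp k n H ι hι hH hloc hn hHreg)

/-- The horizontal residual `GeFourHoriz p` (p508745) from «reach an exit from the start» on the band and B1. [folklore] -/
theorem geFourHoriz_of_reachExit (p : ℕ) (hE : GeFourReachExit p) (hB1 : GoodPointFinish p) : GeFourHoriz p := by
  intro hp k _ _ _ n H ι hι hH hloc hn hHreg
  exact horizAt_of_reachExitAt_of_goodPointFinishAt p k n H ι (hE hp k n H ι hι hH hloc hn hHreg) (hB1 hp k n H ι hι hH hloc)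

/-- **The registered band text (`stub_elnat_ge_four`, v6 = the composition `ge_four` of v8.1) from «reach an exit» and B1** (`stub_elnat_ge_four_of_geFourHoriz`,
p508745) — the TWO-PIECE alternative to the three pieces A, B2, B1. [folklore] -/
theorem stub_elnat_ge_four_of_reachExit (p : ℕ) (hE : GeFourReachExit p) (hB1 : GoodPointFinish p) :
    p.Prime → ∀ (k : Type) [Field k] [CharP k p] [IsAlgClosed k] (n : ℕ) (H : AlgebraicGeometry.Scheme.{0}) (ι : H ⟶ (Literature.AlgebraicGeometry.Motives.projectiveSpace n k).left), AlgebraicGeometry.IsClosedImmersion ι → AlgebraicGeometry.IsIntegral H → (∀ y : (Literature.AlgebraicGeometry.Motives.projectiveSpace n k).left, ∃ U : (Literature.AlgebraicGeometry.Motives.projectiveSpace n k).left.affineOpens, y ∈ (U : (Literature.AlgebraicGeometry.Motives.projectiveSpace n k).left.Opens) ∧ (ι.ker.ideal U).IsPrincipal) → 4 ≤ n → Summit.ResolutionOfSingularities.ResolutionOfSingularities.Theorems.EquisingularLift.ELNatAt p k n H ι :=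
  stub_elnat_ge_four_of_geFourHoriz p (geFourHoriz_of_reachExit p hE hB1)

/-- **THE CRUX BY NAME from «reach an exit» and B1** (every `n`; pure logic + `natAt_of_horizAt`). [folklore] -/
theorem equisingularLiftNat_of_reachExit_of_goodPointFinish (hE : ∀ p : ℕ, ReachExit p) (hB1 : ∀ p : ℕ, GoodPointFinish p) :
    Summit.ResolutionOfSingularities.ResolutionOfSingularities.Theses.EquisingularLift.EquisingularLiftNat := by
  intro p hp k _ _ _ n H ι hι hH hloc
  exact natAt_of_horizAt p k n H ι hι hH
    (horizAt_of_reachExitAt_of_goodPointFinishAt p k n H ι (hE p hp k n H ι hι hH hloc) (hB1 p hp k n H ι hι hH hloc))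

/-- **The crux BY NAME from the band `n ≤ 3` (`UpToThree`, p501020), piece A and piece B2 on the residual band, and B1** — the v8.1 composition with
`stub_elnat_ge_four_finish` replaced by its sub-cut. [folklore] -/
theorem equisingularLiftNat_of_upToThree_of_reach_exit (h3 : ∀ p : ℕ, UpToThree p) (hA : ∀ p : ℕ, GeFourReachIsolated p)
    (hB2 : ∀ p : ℕ, GeFourReachExitIsolated p) (hB1 : ∀ p : ℕ, GoodPointFinish p) :
    Summit.ResolutionOfSingularities.ResolutionOfSingularities.Theses.EquisingularLift.EquisingularLiftNat :=
  equisingularLiftNat_of_upToThree_of_stages h3 hA (fun p => stub_elnat_ge_four_finish_of_exit p (hB1 p) (hB2 p))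

end Summit.ResolutionOfSingularities.ResolutionOfSingularities.Theorems.EquisingularLiftNatPointExit
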